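import Mathlib
import HarnessLib
import HarnessLib.Audit
import Summits.MatrixMultiplication.Statement
import Literature.Computability.AlgebraicComplexity.RectangularExponentAlpha
import HarnessLib.Audit.Status.Attr

/-!
Route: TallFlatOnset

CLOSED (superseded) 2026-08-30T08:15:22Z by planner-decomp-mm-lens-5-g10-0 — reason: superseded:route-MatrixMultiplication-OctaveBudget — superseded by route-MatrixMultiplication-OctaveBudget — note: decomp-mm lens-5 g10 (opener lineage): gen-0 node TallFlatOnset (S ⟺ FiniteSaturation ∧ ExcessDoubling, DRAFT rev 0) is SUPERSEDED by the lineage's gen-3 node OctaveBudget rev 7 (S ⟺ LinearExcessDecay ∧ TailSubcriticalDoubling ∧ SquareLink; tribunal PASSED 04:51:48Z; READY/staffable YES since rev 7). The file is kept as the record of this route; refuted decls are indexed as negative knowledge (`ledger negatives`).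

# Route TallFlatOnset — omega=2 iff exact amortisation starts at a finite shape and the excess obeys
a doubling law

It suffices to show X = FiniteSaturation ∧ ExcessDoubling (and S ⟺ X, proved in the lens draft
`summit_iff_split`).
Axis (decomp-mm lens 5, finite range + asymptotic regime + bridge): the long-shape exponent ω(1,k,1)
= omegaRect ℂ 1 k 1 of ⟨n, n^k, n⟩ and its
excess e(k) := ω(1,k,1) − (k+1) ≥ 0 (e(1) = ω − 2; e non-increasing and convex, kernel; e → 0
PROVED: Coppersmith 1982 / Lotti–Romani 1983 Prop 4.1,
tree `perfectAmortisation_proof` with the kernel rate ω(1,1,k) ≤ (k+2)(log(q+2) − h(1/(k+2)))/log q,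
`omegaRect_le_of_packing`).
FINITE RANGE: FiniteSaturation = ∃ integer k ≥ 2 with e(k) = 0 (the proved limit ATTAINED at a
finite shape; verbatim the item of route FarEdgeDescent,
reached independently). BRIDGE: ExcessDoubling = ∃ C ∀ integer k ≥ 1, e(k) ≤ C·e(2k) (halving the
long dimension costs at most a constant factor of
excess). ASYMPTOTIC REGIME = the proved limit, an anchor and rung, never a piece.
Decomposition-workshop node (decomp-mm gen 0, lens 5); no idea card realised.
Lean: `(∃ k : ℕ, 2 ≤ k ∧ Literature.Computability.AlgebraicComplexity.omegaRect ℂ 1 k 1 = k + 1) ∧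
(∃ C : ℝ, ∀ k : ℕ, 1 ≤ k → Literature.Computability.AlgebraicComplexity.omegaRect ℂ 1 k 1 - (k + 1)
≤ C * (Literature.Computability.AlgebraicComplexity.omegaRect ℂ 1 (2 * k) 1 - (2 * k + 1)))`

## Assembly
Climb and descend: let k ≥ 2 be the shape of FiniteSaturation; monotonicity of rungs (information
bound `add_one_le_omegaRect_one_mid_one` + Lipschitz
bound `omegaRect_one_mid_one_le_add`) gives the rung at the dyadic 2^j ≥ k
(`pow_unbounded_of_one_lt`); ExcessDoubling at 2^{j−1}, …, 2, 1 gives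
e(2^{i}) ≤ C·e(2^{i+1}) = 0, so e(1) = 0, i.e. ω(1,1,1) = 2 = ω (`omegaRect_one_one_one`,
`MatrixMultiplication_iff`). Conversely ω = 2 makes every
ω(1,k,1) = k+1 (k ≥ 1), whence both pieces (`summit_iff_split` in the draft). The deciding theorem
`closes` (glue.lean, 45 lines, tree lemmas only)
consumes exactly the two cruxes (bc6: the Assembly item below is the schema record of the same
implication).

Rationale: WHY THIS LINE. A doubling weight that vanishes at one dyadic scale vanishes at every smaller one
(e(k) ≤ C·e(2k) = C·0), and rungs climb for free (e non-increasing,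
LottiRomani1983 §2, kernel `omegaRect_one_mid_one_le_add`), so exact amortisation at ONE finite
shape k climbs to a dyadic 2^j ≥ k and descends by j
halvings to the square: ω = 2 is cut into "the Lotti–Romani / Coppersmith limit is attained at a
finite shape" (LottiRomani1983 Prop 4.1, Coppersmith1982,
HuangPan1998 §8) and "un-amortisation costs a bounded factor of excess, uniformly in the scale" — a
self-similarity law of the excess profile imported from
the doubling/Δ₂-condition vocabulary of harmonic analysis and Orlicz theory (a weight w with w(k) ≤
C w(2k)), with the constant left free (∃ C) so that no
hand-picked rate is bet on. Each piece holds in an explicit ω > 2 model profile consistent with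
every kernel and printed constraint (kink e(x) = 0.3(2−x)⁺:
finite saturation true, doubling false; Hölder e(x) = 0.3x^{−0.6}: no finite rung, doubling true
with C = 1.52, ω = 2.3, ω(1,2,1) = 3.198 ≤ 3.2504; log-Lipschitz
e(x) = 0.3e^{1−x}: both false), so all four truth-value combinations occur and neither piece is
decided by the other or by S. Prior routes on this axis
(EPRFaces closed: face law ω − 2 ≤ e(k) ≡ S; ShapeSubmodularity / LongBlockAmortisation closed;
CubicExchangeSplit dormant: S ⟺ E₃ ∧ SUBMOD₃) fix a cell k
and tie ω ITSELF to e(k) by a geometric constant (1 = face, 2 = exchange); FarEdgeDescent (born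
today, lens 2) pairs the same finite piece with
log-convexity e(k)² ≤ e(k−1)e(k+1) plus a separate square link. This line's bridge is two-term,
scale-uniform, reaches k = 1 by itself (2 pieces, not 3),
and is incomparable with log-convexity (exponential decay c·a^{−k} is log-convex but not doubling; a
convex, non-log-convex profile with bounded octave
ratios is doubling but not log-convex); negatives index: 12 entries, none on the exponent profile.

RANKED CRUXES. #2 ExcessDoubling (crux) — BRIDGE — doubling law for the long-shape excess: there is
a constant C with ω(1,k,1) − (k+1) ≤ C·(ω(1,2k,1) − (2k+1)) for every integer k ≥ 1 (halving the
long dimension of ⟨n, n^{2k}, n⟩ costs at most a constant factor of excess; forbids a kink of k ↦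
ω(1,k,1) at a finite k₀ > 1 and super-polynomial decay of the excess along the dyadics). Tag WEAKER
(S ⟹ P kernel `excessDoubling_of_summit`, C = 0; P holds for e(k) = 0.3k^{−0.6} with ω = 2.3); leaf
INSTRUMENTABLE (I3: doubling constant of the record profile ê(1)/ê(2) = 0.371552/0.250385 = 1.484,
ê(1.5)/ê(3) = 0.294941/0.198809 = 1.484; of the kernel CW_q profile ≤ 1.222, → 1) → IDEA-NEEDED (an
un-amortisation mechanism; blocking gives only e(2k) ≤ e(k)). [difficulty: XL] (why it might fail: a
transversal contact of the spectrum of shapes (flatness starting at a finite k₀ > 1 while ω > 2) or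
exponential decay e(k) ~ c·a^{-k} violates it; no technique converts ⟨n,n,n^{2k}⟩-algorithms into
⟨n,n,n^k⟩-algorithms beyond blocking.) [LottiRomani1983, Coppersmith1982,
VassilevskaWilliamsXuXuZhou2024, HuangPan1998]
#3 FiniteSaturation (crux) — FINITE RANGE — the Lotti–Romani / Coppersmith limit is attained: some
unbalanced product ⟨n, n^k, n⟩ with integer k ≥ 2 has exactly the information exponent, ω(1,k,1) = k
+ 1 (⟺ ∃ real k ≥ 1, ω(1,1,k) = k+1, kernel `finiteSaturation_iff_real`; ⟺ ∃ k ≥ 1, R̃(⟨2,2,2^k⟩) =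
2^{k+1}, tree `asymptoticRank_right_le_iff`). VERBATIM the item stmt-MatrixMultiplication-23739 of
route FarEdgeDescent (dedup-attach intended; lenses 2 and 5 reached it independently). Tag WEAKER (S
⟹ P kernel `finiteSaturation_of_summit`; P pays only ω ≤ 3(k+1)/(k+2), tree
`omega_le_of_right_rung_real`: 9/4, 12/5, 2.7 at k = 2, 3, 8, and nothing with k existential; holds
at k = 2 in the kink model with ω = 2.3); leaf BARRIER(CW_q T-methods at every finite k: CLLZ Thm
3.15, kernel `CLLZ2025_omegaTwo_barrier_CW_holds`, Table 1 `cllz2025OmegaTwoTable` 3.0626…3.1714 > 3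
at k = 2) + IDEA-NEEDED + INSTRUMENTABLE (I1: CLLZ eq. (5) barrier excess b_q(k) − (k+1) for k ∈
{2,3,4,8,16,32}, q ≤ 64; I2: kernel CW_q rate table min_q f(k,q) − (k+1), k ≤ 64: 0.3398, 0.2790,
0.2290, 0.1908, 0.1620 at k = 2, 4, 8, 16, 32). [difficulty: open-problem] (why it might fail: if ω
> 2 the spectrum of shapes may touch the information bound tangentially — e(k) > 0 for every k, e.g.
e ~ 1/log k as the kernel CW_q profile suggests; every CW_q T-method is barred at every finite k and
no tensor family sharp on two legs is known.) [LottiRomani1983, Coppersmith1982,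
ChristandlLeGallLysikovZuiddam2025, VassilevskaWilliamsXuXuZhou2024, LeGall2012]

TWO-LAYER PLAN. FiniteSaturation ⇐ (E_k for a specific k: E₃ =
`CubicExchangeSplit.CubicAmortisation` in exponent form, or E₂ = ω(1,2,1) = 3, or R̃(⟨2,2,4⟩) ≤ 8
via
`asymptoticRank_224_le_iff`) — any E_k closes it by ⟨k, _, h⟩; CITED, not re-typed. ExcessDoubling ⇐
(a real-shape form ∃C ∀ real k ≥ 1, e(k) ≤ C e(2k),
stronger; or a rate form ∃θ ∀k, e(k) ≥ e(1)·k^{−θ}, stronger) — foreseen once an un-amortisation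
mechanism is named (IDEA-NEEDED). Nothing filed now.

KILL CRITERIA. A refutation of ExcessDoubling needs LOWER bounds ω(1,k,1) > k+1 at some finite k
(none exist short of ω > 2) — a proof of "∀C ∃k e(k) > C e(2k)" closes
the route `refuted:ExcessDoubling`; a proof that e(k) > 0 for all k refutes FiniteSaturation (and,
with the kernel dichotomy `finiteSaturation_or_onsetRigidity`,
proves OnsetRigidity) and closes it `refuted:FiniteSaturation`. A proof of any E_k contracts the
route to ExcessDoubling restricted to k′ ≤ k (finitely many
octaves); a proof of E₂ contracts it to the single octave e(1) ≤ C e(2) = 0, i.e. to S itself — then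
the route is moot and should be closed superseded.

NOT DECOMPOSED YET. The un-amortisation mechanism behind ExcessDoubling (which tensor construction
trades a long ⟨n,n,n^{2k}⟩-algorithm for a ⟨n,n,n^k⟩-algorithm at
bounded excess cost); the value of C (deliberately ∃); the choice of k in FiniteSaturation (the
route does not bet on a cell); real shapes and the
spectral reading (onset = contact slope g′(0⁺) of the spectrum's shadow at its top face; S ⟺ g′(0⁺)
≤ 1, FiniteSaturation ⟺ g′(0⁺) < ∞) stay informal.
The exact residual OnsetRigidity (FiniteSaturation → S; kernel `onsetRigidity_iff_residual`, implied
by ExcessDoubling) and the anchor TallExcessVanishes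
(Lotti–Romani, kernel in rank form) live in the lens draft as asides, not items.

CHEAPEST FALSIFIER. Instrument I3 inside the two computable worlds (minutes for a census seat;
kit_allowed = false here, done by hand for the CW_q closed form): the octave
ratios e(k)/e(2k) of (a) the kernel first-power CW_q profile min_q f(k,q) − (k+1): 1.188 (k=1),
1.222 (k=3, the maximum), 1.121 (k=128), → 1 — bounded,
consistent; (b) the record profile (VXXZ 2024 Table 1): 1.484 at k = 1 and k = 1.5 — bounded,
consistent; (c) the CLLZ barrier profile b_q(k) (I1, not
run). An octave ratio growing without bound in any self-consistent method world would remove the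
bridge's only structural evidence.

NUMBERS. ω ≤ 2.371339 (ADVXXZ 2025; kernel 2.37295); ω(1,2,1) ≤ 3.250035 (ADVXXZ 2025,
`advxxz2025_omegaRect_table`), ≤ 3.250385; ω(1,1.5,1) ≤ 2.794941;
ω(1,3,1) ≤ 4.198809 (VXXZ 2024, `vxxz2024_omegaRect_table`); CW-method barrier ω̂(1,2,1) ≥ 3.0626
(q=2) … 3.1714 (q=14) (CLLZ 2025 Table 1,
`cllz2025OmegaTwoTable`); kernel CW_q rate excess min_q f(k,q) − (k+1) = 0.4036 (k=1, q=8 = CW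
2.404), 0.3398 (k=2, q=10 = Huang–Pan (3.6)),
0.2790 (4), 0.2290 (8), 0.1908 (16), 0.1620 (32), 0.1403 (64), 0.0903 (1024) ≈ 1/(log₂(k+2)+1);
prices E_k ⟹ ω ≤ 3(k+1)/(k+2) = 2.25, 2.4, 2.5,
2.7, 2.833 at k = 2, 3, 4, 8, 16 (tree `omega_le_of_right_rung_real`).

DEFINITION REQUESTS. None (both pieces are over `omegaRect` / `omega`).

Novelty: Searches (2026-08-30): rg over the 80 Theses/*.lean of the sub for `omegaRect ℂ 1 1|omegaRect ℂ 1 k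
1|doubling|amortis` (hits: EPRFaces, ShapeSubmodularity, LongBlockAmortisation, CubicExchangeSplit,
FarEdgeDescent — all read; none has a two-scale law e(k) vs e(2k)); cell TREE.md v1 and
COSTUME-CENSUS v1 rows W3/W5/R10/R11; `ledger negatives` list (12, via TREE.md); lit search --hybrid
"rectangular matrix multiplication exponent omega(1,1,k) equal to k+1 finite k" and "reduction from
n by n^2k to n by n^k products amortized converse of blocking" (corpus: LottiRomani1983 p.10–11 Prop
4.1, HuangPan1998 §8.1, LeGall2012 §1 — limit / records only); lit vsearch of both statements in
prose (no statement-level hit); lit galaxy search --star all "omega(1,1,k)|ω(1,1,k)|n x n^k matri"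
(0 hits) and "omega(1,1,2k)|doubling the aspect ratio|Rapid multiplication of rectangular" (generic
hits only).
Nearest prior art found: LottiRomani1983 Prop 2.1/4.1 (monotonicity, convexity, the limit); route
FarEdgeDescent (lens 2, born 2026-08-30: same finite piece + log-convexity + square link); route
CubicExchangeSplit (S ⟺ E₃ ∧ SUBMOD₃); tree `SoloInformedTwoSidedLadder` (rungs, chain, limit as
hypothesis — vocabulary, no decomposition).
Delta: the existential end of the amortisation dial paired with a two-term, scale-uniform,
free-constant self-similarity law of the excess (doubling), which reaches the square by itself and
is incomparable with both the exchange laws and log-convexity — a new exact  [refs: LottiRomani1983, HuangPan1998, LeGall2012]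

Barriers (technique_class: rectangular-exponents, spectrum-geometry, self-similarity): - technique_class: rectangular-exponents, spectrum-geometry, self-similarity
- Literature.Barriers.MatrixMultiplication.RectangularBarrier: bites FiniteSaturation for every CW_q
T-method at every finite k (`CLLZ2025_omegaTwo_barrier_CW_holds` at k = 2; the support-functional
envelope θ = ((1−θ₁)/2, θ₁, (1−θ₁)/2) gives ω̂(k) ≥ k+1+2θ₁+O(θ₁²) > k+1 for every q, k); it does
not evade it: the bet is a tensor family sharp on two legs outside the CW_q class; ExcessDoubling is
an inequality BETWEEN exponents at two shapes, outside the class (certifies no single exponent).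
- Literature.Barriers.MatrixMultiplication.UniversalMethodBarrier: stated for ω from a fixed tensor;
FiniteSaturation inherits it exactly as the summit does (the node RELOCATES B1/B2 to the corner
vertex, where tangency is a theorem); ExcessDoubling uses no fixed starting tensor (outside).
- Literature.Barriers.MatrixMultiplication.IrreversibilityBarrier: same placement as
UniversalMethodBarrier (rectangular analogue = CLLZ).
- Literature.Barriers.MatrixMultiplication.InfimumNotMinimumBarrier: outside — both pieces are
infima over algorithms at fixed shape exponents (asymptotic statements), never a fixed-format rank
certificate; "attained" refers to the shape, not to a tensor power (tree
`pow_lt_algBorderRank_kroneckerPow_right` respected).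
- Negatives index: 12 refuted statements (HyperoctahedralThreshold, TightWindows,
PrimeValConjecture, ModuleRankGrowth, HexagonClearance, ConeDesignThesis, RectangularThmB, Sepa

History (route lifecycle, newest last):
- 2026-08-30T08:15:23Z · CLOSED superseded — superseded:route-MatrixMultiplication-OctaveBudget (planner-decomp-mm-lens-5-g10-0)

sub-problem: MatrixMultiplication · status: closed(superseded) · opened planner-decomp-mm-lens-5-g0-0 2026-08-30T01:41:56Z · rev 0 · ledger route-MatrixMultiplication-TallFlatOnset
GENERATED by the gate from the ledger (D-0016/17). Provers cite these decls: `theorem foo : Summit.MatrixMultiplication.MatrixMultiplication.Theses.TallFlatOnset.<Decl> := …` in Summits/MatrixMultiplication/MatrixMultiplication/Theorems/<Name>.lean.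
-/

namespace Summit.MatrixMultiplication.MatrixMultiplication.Theses.TallFlatOnset

open scoped BigOperators Topology Manifold Classical MeasureTheory ProbabilityTheory Matrix InnerProductSpace ComplexConjugate ContinuousMap
open Filter Set Function TopologicalSpace MeasureTheory

attribute [summit_statement] _root_.MatrixMultiplication

/-- item stmt-MatrixMultiplication-24159 · crux · rank 2 · open · by planner
why it might fail: a transversal contact of the spectrum of shapes (flatness starting at a finite k₀ > 1 while ω > 2) or exponential decay e(k) ~ c·a^{-k} violates it; no technique converts ⟨n,n,n^{2k}⟩-algorithms into ⟨n,n,n^k⟩-algorithms beyond blocking.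
sources: LottiRomani1983, Coppersmith1982, VassilevskaWilliamsXuXuZhou2024, HuangPan1998
[crux] BRIDGE — doubling law for the long-shape excess: there is a constant C with ω(1,k,1) − (k+1)
≤ C·(ω(1,2k,1) − (2k+1)) for every integer k ≥ 1 (halving the long dimension of ⟨n, n^{2k}, n⟩ costs
at most a constant factor of excess; forbids a kink of k ↦ ω(1,k,1) at a finite k₀ > 1 and
super-polynomial decay of the excess along the dyadics). Tag WEAKER (S ⟹ P kernel
`excessDoubling_of_summit`, C = 0; P holds for e(k) = 0.3k^{−0.6} with ω = 2.3); leaf INSTRUMENTABLE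
(I3: doubling constant of the record profile ê(1)/ê(2) = 0.371552/0.250385 = 1.484, ê(1.5)/ê(3) =
0.294941/0.198809 = 1.484; of the kernel CW_q profile ≤ 1.222, → 1) → IDEA-NEEDED (an
un-amortisation mechanism; blocking gives only e(2k) ≤ e(k)). [difficulty: XL] -/
@[route_item "route-MatrixMultiplication-TallFlatOnset", crux]
def ExcessDoubling : Prop :=
  ∃ C : ℝ, ∀ k : ℕ, 1 ≤ k → Literature.Computability.AlgebraicComplexity.omegaRect ℂ 1 k 1 - (k + 1) ≤ C * (Literature.Computability.AlgebraicComplexity.omegaRect ℂ 1 (2 * k) 1 - (2 * k + 1))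

/-- item stmt-MatrixMultiplication-23739 · crux · rank 3 · open · by planner
why it might fail: if ω > 2 the spectrum of shapes may touch the information bound tangentially — e(k) > 0 for every k, e.g. e ~ 1/log k as the kernel CW_q profile suggests; every CW_q T-method is barred at every finite k and no tensor family sharp on two legs is known.
sources: LottiRomani1983, Coppersmith1982, ChristandlLeGallLysikovZuiddam2025, VassilevskaWilliamsXuXuZhou2024, LeGall2012
[crux] SPECIAL side — the Lotti–Romani infimum is attained: some unbalanced product ⟨n, n^k, n⟩ with
integer k ≥ 2 has exactly the information exponent, ω(1,k,1) = k + 1 (β := inf{k : e(k) = 0} < ∞;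
the k* of the closed card far-edge-kstar-amortised-matvec). Tag WEAKER (S ⟹ P kernel
`finiteSaturation_of_mm`; P pays only ω ≤ 3(k+1)/(k+2), kernel `omega_le_of_saturated` in the lens
draft, and holds with β ≈ 2.77 in the one-dark-vertex model); leaf IDEA-NEEDED + BARRIER(CW_q
T-methods: CLLZ Thm 3.15, tree `IsAdequate.barrier`, Table 1 `cllz2025OmegaTwoTable`) +
INSTRUMENTABLE (test T1: CLLZ eq. (5) barrier excess b_q(k) − (k+1) as k grows). [difficulty:
open-problem] -/
@[route_item "route-MatrixMultiplication-TallFlatOnset", crux]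
def FiniteSaturation : Prop :=
  ∃ k : ℕ, 2 ≤ k ∧ Literature.Computability.AlgebraicComplexity.omegaRect ℂ 1 k 1 = k + 1

/-- item stmt-MatrixMultiplication-24160 · assembly · rank 1 · closed · moot by None · by planner
sources: LottiRomani1983, Coppersmith1982
[assembly] FiniteSaturation → ExcessDoubling → ω(ℂ) = 2. -/
@[route_item "route-MatrixMultiplication-TallFlatOnset"]
def Assembly : Prop :=
  FiniteSaturation → ExcessDoubling → _root_.MatrixMultiplication

/-! D-0027 §2.1 — DECIDING THEOREM (planner-authored via `route open/edit --closes-file`; by planner-decomp-mm-lens-5-g0-0 2026-08-30T01:41:56Z) — ARCHIVED: route closed (superseded) 2026-08-30T08:15:22Z; kept so importers keep building: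
its hypotheses are this route's items and its conclusion the sub-problem Statement (glue_lint), and it elaborates with this file. -/

@[closes "route-MatrixMultiplication-TallFlatOnset"] theorem closes (h₁ : FiniteSaturation) (h₂ : ExcessDoubling) : _root_.MatrixMultiplication := by
  -- information bound (floor) and monotonicity of rungs along the long-shape axis
  have floor : ∀ p : ℝ, p + 1 ≤ Literature.Computability.AlgebraicComplexity.omegaRect ℂ 1 p 1 :=
    fun p => Literature.Computability.AlgebraicComplexity.add_one_le_omegaRect_one_mid_one ℂ p
  have mono : ∀ p q : ℝ, q ≤ p →
      Literature.Computability.AlgebraicComplexity.omegaRect ℂ 1 q 1 = q + 1 →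
      Literature.Computability.AlgebraicComplexity.omegaRect ℂ 1 p 1 = p + 1 := by
    intro p q hqp h
    have h1 := Literature.Computability.AlgebraicComplexity.omegaRect_one_mid_one_le_add ℂ hqp
    have h2 := floor p
    linarith
  obtain ⟨C, hC⟩ := h₂
  -- one halving step: the rung at 2k gives the rung at k
  have half : ∀ k : ℕ, 1 ≤ k →
      Literature.Computability.AlgebraicComplexity.omegaRect ℂ 1 (2 * (k : ℝ)) 1 = 2 * (k : ℝ) + 1 →
      Literature.Computability.AlgebraicComplexity.omegaRect ℂ 1 (k : ℝ) 1 = (k : ℝ) + 1 := by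
    intro k hk h2
    have h := hC k hk
    rw [h2, sub_self, mul_zero] at h
    exact le_antisymm (by linarith) (floor k)
  -- dyadic descent from 2^j to 1
  have desc : ∀ j : ℕ,
      Literature.Computability.AlgebraicComplexity.omegaRect ℂ 1 ((2 : ℝ) ^ j) 1 = (2 : ℝ) ^ j + 1 →
      Literature.Computability.AlgebraicComplexity.omegaRect ℂ 1 1 1 = 1 + 1 := by
    intro j
    induction j with
    | zero => intro h; simpa using h
    | succ j ih =>
      intro h
      apply ih
      have h2 : Literature.Computability.AlgebraicComplexity.omegaRect ℂ 1 (2 * ((2 ^ j : ℕ) : ℝ)) 1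
          = 2 * ((2 ^ j : ℕ) : ℝ) + 1 := by
        push_cast
        rw [← pow_succ']
        exact h
      have h3 := half (2 ^ j) Nat.one_le_two_pow h2
      push_cast at h3
      exact h3
  -- climb from the finite saturation point k to a dyadic 2^j ≥ k, then descend
  obtain ⟨k, _, hrung⟩ := h₁
  obtain ⟨j, hj⟩ := pow_unbounded_of_one_lt (k : ℝ) (by norm_num : (1 : ℝ) < 2)
  have h2j := mono ((2 : ℝ) ^ j) (k : ℝ) hj.le hrung
  have h1 := desc j h2j
  rw [Literature.Computability.AlgebraicComplexity.omegaRect_one_one_one] at h1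
  rw [_root_.MatrixMultiplication_iff]
  norm_num at h1
  exact h1

end Summit.MatrixMultiplication.MatrixMultiplication.Theses.TallFlatOnset
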